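import Summits.KontsevichZagierPeriods.KontsevichZagierPeriods.Theorems.TerasomaMultiplicationBetaCancellationStubTameFormAux22
import Literature.ModelTheory.ExponentialFields.SemialgebraicDimension

/-!
# `BetaCancellation` (stmt-KontsevichZagierPeriods-13633), line `divisor-slicing-transshipment` — stub `stub_tameForm`, auxiliary file 23: fibre combinatorics of an adapted stack over a Newton–Leibniz band

Over a base set `S` let `ξ₀ < ⋯ < ξ_{l-1}` be sections and let the closed band `{a x ≤ t ≤ b x}`
(`a < b` on `S`) have fibres `⋃_{j ∈ Gs} {ξⱼ x} ∪ ⋃_{j ∈ Bs} (ξ_{j-1} x, ξⱼ x)` for FIXED index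
sets `Gs`, `Bs` (this is what adaptedness of a cylindrical decomposition gives). Then
`a = ξ_{j₀}`, `b = ξ_{j₁}` for `j₀ = min Gs`, `j₁ = max Gs`, the bands inside are exactly
`j₀ < j ≤ j₁`, and boundary terms telescope: `∑_{j ∈ Bs} (G_{j} − G_{j-1}) = G_{j₁} − G_{j₀}`.

References: S. Basu, R. Pollack, M.-F. Roy, *Algorithms in Real Algebraic Geometry* (2006), Def. 5.1,
Cor. 5.7; M. Kontsevich, D. Zagier, *Periods* (2001), §1.2 rule (3).
-/

noncomputable section

-- `Summit.KontsevichZagierPeriods.KontsevichZagierPeriods.…` is the tree's mandated layout (single-conjunct summit).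
set_option linter.dupNamespace false

namespace Summit.KontsevichZagierPeriods.KontsevichZagierPeriods.BetaCancellationDivisorSlicing

open MeasureTheory Set Function Filter
open Literature.NumberTheory.Transcendental
open Literature.NumberTheory.Transcendental.KZ
open Literature.ModelTheory.ExponentialFields (IsSemialgebraic isSemialgebraic_univ bandLower bandUpper bandOver graphOver
  bandLower_of_ne_zero bandUpper_of_ne_last)
open Literature.ModelTheory.ExponentialFields.CylindricalDecomposition (band_eq_band not_mem_band_of_eq exists_mem_band)

variable {n l : ℕ}

/-- **Fibre combinatorics of an adapted stack over a closed band.** [cite: BasuPollackRoy2006, Def. 5.1] -/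
theorem exists_band_indices {S : Set (Fin n → ℝ)} {ξ : Fin l → (Fin n → ℝ) → ℝ}
    (hmono : ∀ x ∈ S, StrictMono fun i => ξ i x) {a b : (Fin n → ℝ) → ℝ} (hab : ∀ x ∈ S, a x < b x)
    (hS : S.Nonempty) {Gs : Finset (Fin l)} {Bs : Finset (Fin (l + 1))}
    (hfib : ∀ x ∈ S, ∀ t : ℝ, t ∈ Icc (a x) (b x) ↔
      (∃ j ∈ Gs, t = ξ j x) ∨ ∃ j ∈ Bs, bandLower ξ j x < t ∧ (t : EReal) < bandUpper ξ j x) :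
    ∃ j₀ j₁ : Fin l, j₀ ≤ j₁ ∧ (∀ x ∈ S, ξ j₀ x = a x) ∧ (∀ x ∈ S, ξ j₁ x = b x) ∧
      ∀ j : Fin (l + 1), j ∈ Bs ↔ (j₀ : ℕ) < j ∧ (j : ℕ) ≤ j₁ := by
  obtain ⟨x₀, hx₀⟩ := hS
  -- endpoints are section values
  have hbound : ∀ x ∈ S, ∀ t ∈ Icc (a x) (b x), (t = a x ∨ t = b x) → ∃ j ∈ Gs, t = ξ j x := by
    intro x hx t ht hend
    rcases (hfib x hx t).mp ht with h | ⟨j, hj, hlo, hup⟩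
    · exact h
    · exfalso
      rcases hend with rfl | rfl
      · obtain ⟨t', ht'lo, ht'up⟩ := EReal.exists_between_coe_real hlo
        have ht'up' : ((t' : ℝ) : EReal) < bandUpper ξ j x := lt_trans ht'up hup
        have := ((hfib x hx t').mpr (Or.inr ⟨j, hj, ht'lo, ht'up'⟩)).1
        have h2 : t' < a x := by exact_mod_cast ht'up
        linarith
      · obtain ⟨t', ht'lo, ht'up⟩ := EReal.exists_between_coe_real hup
        have ht'lo' : bandLower ξ j x < ((t' : ℝ) : EReal) := lt_trans hlo ht'lo
        have := ((hfib x hx t').mpr (Or.inr ⟨j, hj, ht'lo', ht'up⟩)).2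
        have h2 : b x < t' := by exact_mod_cast ht'lo
        linarith
  have hGs_mem : ∀ x ∈ S, ∀ j ∈ Gs, ξ j x ∈ Icc (a x) (b x) := fun x hx j hj =>
    (hfib x hx _).mpr (Or.inl ⟨j, hj, rfl⟩)
  obtain ⟨ja, hja, hja'⟩ := hbound x₀ hx₀ (a x₀) (left_mem_Icc.mpr (hab x₀ hx₀).le) (Or.inl rfl)
  have hne : Gs.Nonempty := ⟨ja, hja⟩
  set j₀ := Gs.min' hne
  set j₁ := Gs.max' hne
  have hj₀ : j₀ ∈ Gs := Gs.min'_mem hne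
  have hj₁ : j₁ ∈ Gs := Gs.max'_mem hne
  have ha : ∀ x ∈ S, ξ j₀ x = a x := by
    intro x hx
    obtain ⟨j, hj, hjx⟩ := hbound x hx (a x) (left_mem_Icc.mpr (hab x hx).le) (Or.inl rfl)
    have h1 : ξ j₀ x ≤ ξ j x := (hmono x hx).monotone (Gs.min'_le j hj)
    have h2 := (hGs_mem x hx j₀ hj₀).1
    linarith
  have hb : ∀ x ∈ S, ξ j₁ x = b x := by
    intro x hx
    obtain ⟨j, hj, hjx⟩ := hbound x hx (b x) (right_mem_Icc.mpr (hab x hx).le) (Or.inr rfl)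
    have h1 : ξ j x ≤ ξ j₁ x := (hmono x hx).monotone (Gs.le_max' j hj)
    have h2 := (hGs_mem x hx j₁ hj₁).2
    linarith
  refine ⟨j₀, j₁, Gs.min'_le j₁ hj₁, ha, hb, fun j => ⟨fun hj => ?_, fun ⟨h1, h2⟩ => ?_⟩⟩
  · obtain ⟨t, htlo, htup⟩ := exists_mem_band ξ x₀ (hmono x₀ hx₀) j
    have ht := (hfib x₀ hx₀ t).mpr (Or.inr ⟨j, hj, htlo, htup⟩)
    constructor
    · by_contra hle
      push Not at hle
      have hjl : j ≠ Fin.last l := fun h => by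
        rw [h, Fin.val_last] at hle; exact absurd j₀.2 (not_lt.mpr hle)
      rw [bandUpper_of_ne_last ξ j hjl, EReal.coe_lt_coe_iff] at htup
      have hmono' : ξ (j.castPred hjl) x₀ ≤ ξ j₀ x₀ := (hmono x₀ hx₀).monotone (by
        rw [Fin.le_def, Fin.coe_castPred]; exact hle)
      linarith [ht.1, ha x₀ hx₀]
    · by_contra hlt
      push Not at hlt
      have hj0 : j ≠ 0 := fun h => by rw [h] at hlt; exact Nat.not_lt_zero _ hlt
      rw [bandLower_of_ne_zero ξ j hj0, EReal.coe_lt_coe_iff] at htlo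
      have hmono' : ξ j₁ x₀ ≤ ξ (j.pred hj0) x₀ := (hmono x₀ hx₀).monotone (by
        rw [Fin.le_def, Fin.val_pred]; omega)
      linarith [ht.2, hb x₀ hx₀]
  · have hj0 : j ≠ 0 := fun h => by rw [h] at h1; exact Nat.not_lt_zero _ h1
    have hjl : j ≠ Fin.last l := fun h => by rw [h, Fin.val_last] at h2; exact absurd j₁.2 (not_lt.mpr h2)
    obtain ⟨t, htlo, htup⟩ := exists_mem_band ξ x₀ (hmono x₀ hx₀) j
    have htlo' := htlo
    have htup' := htup
    rw [bandLower_of_ne_zero ξ j hj0, EReal.coe_lt_coe_iff] at htlo'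
    rw [bandUpper_of_ne_last ξ j hjl, EReal.coe_lt_coe_iff] at htup'
    have hlo : ξ j₀ x₀ ≤ ξ (j.pred hj0) x₀ := (hmono x₀ hx₀).monotone (by
      rw [Fin.le_def, Fin.val_pred]; omega)
    have hup : ξ (j.castPred hjl) x₀ ≤ ξ j₁ x₀ := (hmono x₀ hx₀).monotone (by
      rw [Fin.le_def, Fin.coe_castPred]; exact h2)
    have ht : t ∈ Icc (a x₀) (b x₀) := by
      rw [← ha x₀ hx₀, ← hb x₀ hx₀]; constructor <;> linarith
    rcases (hfib x₀ hx₀ t).mp ht with ⟨i, -, hi⟩ | ⟨j', hj', hj'lo, hj'up⟩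
    · exact absurd ⟨htlo, htup⟩ (not_mem_band_of_eq ξ x₀ (hmono x₀ hx₀) hi)
    · rwa [band_eq_band ξ x₀ (hmono x₀ hx₀) ⟨htlo, htup⟩ ⟨hj'lo, hj'up⟩]

/-- **Telescoping of the boundary terms over the bands inside a closed band.** [folklore] -/
theorem sum_bands_telescope {Bs : Finset (Fin (l + 1))} {j₀ j₁ : Fin l} (hle : j₀ ≤ j₁)
    (hBs : ∀ j : Fin (l + 1), j ∈ Bs ↔ (j₀ : ℕ) < j ∧ (j : ℕ) ≤ j₁) (G : Fin l → ℝ) :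
    ∑ j ∈ Bs, (if h : j ≠ 0 ∧ j ≠ Fin.last l then G (j.castPred h.2) - G (j.pred h.1) else 0) = G j₁ - G j₀ := by
  -- reindex by `i ↦ j₀ + i + 1`, `i < j₁ - j₀`
  let g : ℕ → ℝ := fun m => if h : m < l then G ⟨m, h⟩ else 0
  have hg : ∀ j : Fin l, G j = g j := fun j => by simp [g, j.2]
  have key : ∑ j ∈ Bs, (if h : j ≠ 0 ∧ j ≠ Fin.last l then G (j.castPred h.2) - G (j.pred h.1) else 0) =
      ∑ i ∈ Finset.range (j₁ - j₀ : ℕ), ((fun i => g (j₀ + i)) (i + 1) - (fun i => g (j₀ + i)) i) := by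
    refine Finset.sum_nbij' (fun j : Fin (l + 1) => (j : ℕ) - j₀ - 1)
      (fun i : ℕ => (⟨min ((j₀ : ℕ) + i + 1) l, by omega⟩ : Fin (l + 1))) ?_ ?_ ?_ ?_ ?_
    · intro j hj
      have := (hBs j).mp hj
      simp only [Finset.mem_range]; omega
    · intro i hi
      simp only [Finset.mem_range] at hi ⊢
      rw [hBs]; simp only; omega
    · intro j hj
      have := (hBs j).mp hj
      ext; simp only; omega
    · intro i hi
      simp only [Finset.mem_range] at hi
      simp only; omega
    · intro j hj
      have hj' := (hBs j).mp hj
      have h0 : j ≠ 0 := fun h => by rw [h] at hj'; exact Nat.not_lt_zero _ hj'.1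
      have hl : j ≠ Fin.last l := fun h => by rw [h, Fin.val_last] at hj'; exact absurd j₁.2 (not_lt.mpr hj'.2)
      rw [dif_pos ⟨h0, hl⟩, hg, hg]
      show g _ - g _ = g ((j₀ : ℕ) + (((j : ℕ) - j₀ - 1) + 1)) - g ((j₀ : ℕ) + ((j : ℕ) - j₀ - 1))
      have e1 : ((j.castPred hl : Fin l) : ℕ) = (j₀ : ℕ) + (((j : ℕ) - j₀ - 1) + 1) := by
        rw [Fin.coe_castPred]; omega
      have e2 : ((j.pred h0 : Fin l) : ℕ) = (j₀ : ℕ) + ((j : ℕ) - j₀ - 1) := by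
        rw [Fin.val_pred]; omega
      rw [e1, e2]
  rw [key]
  refine (Finset.sum_range_sub (fun i => g ((j₀ : ℕ) + i)) (j₁ - j₀ : ℕ)).trans ?_
  rw [hg, hg]
  show g ((j₀ : ℕ) + (j₁ - j₀ : ℕ)) - g ((j₀ : ℕ) + 0) = g j₁ - g j₀
  have : (j₀ : ℕ) + (j₁ - j₀ : ℕ) = j₁ := by
    have : (j₀ : ℕ) ≤ j₁ := hle
    omega
  rw [this, Nat.add_zero]

/-! ### Headline -/

/-- Registered helper goal of the stub `stub_tameForm`: telescoping of boundary terms over the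
bands inside a closed band. [folklore] -/
theorem tameForm_aux_telescope : ∀ {l : ℕ} {Bs : Finset (Fin (l + 1))} {j₀ j₁ : Fin l}, j₀ ≤ j₁ → (∀ j : Fin (l + 1), j ∈ Bs ↔ (j₀ : ℕ) < j ∧ (j : ℕ) ≤ j₁) → ∀ G : Fin l → ℝ, ∑ j ∈ Bs, (if h : j ≠ 0 ∧ j ≠ Fin.last l then G (j.castPred h.2) - G (j.pred h.1) else 0) = G j₁ - G j₀ :=
  fun hle hBs G => sum_bands_telescope hle hBs G

end Summit.KontsevichZagierPeriods.KontsevichZagierPeriods.BetaCancellationDivisorSlicing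

end
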